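import Literature.AlgebraicGeometry.Motives.AbelianVarietyConjugateBaseChangeAlong
import Literature.AlgebraicGeometry.Motives.AbelianVarietyGoodReductionConjugate
import Literature.NumberTheory.EllipticCurves.TateModuleBaseChange
import HarnessLib

/-!
# The `σ̃`-transport `A(K̄) ≃ A^γ(K̄)` of geometric points and its lift to the Tate module
# (Shimura 1998, §18.6 proof of Thm. 18.6, p. 129: «`x ↦ x^σ`», `(Y^σ)~ = Ỹ^f`)

Topic `Literature/AlgebraicGeometry/Motives`, namespace `Literature.AlgebraicGeometry.Motives.AbelianVariety`.
DEFINITIONS WITH BODIES and THEOREMS, all proved; no named fact, no instance, no notation (net Literature debt 0).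
Written for the cell `hodgecm-mathlib` (D-0151), line E4 of the h21 rung (`S5c′`), LEAF L1 of the transport file
`GoodReductionAt.TateSpecialisation.conjFrob` (lead B-p09, harness `ConjFrob-harness.lean` sha16 5072909d5ac13c61;
B-p20's E4 ruling 2026-08-28T08:27:54Z (3)).

## The printed step

G. Shimura, *Abelian Varieties with Complex Multiplication and Modular Functions* (Princeton 1998) [Shimura1998],
§18.6, proof of Thm. 18.6, p. 129 (held chunk p0167): for `σ ∈ Aut(ℂ/K*)` whose restriction to the field of
rationality `L ⊃ K` of the model is the Frobenius `[𝔓, L/K*]`, every object `Y` rational over `L` has a conjugate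
`Y^σ`, points go to points, `t ↦ t^σ` on `A[ℓ^m]`, homomorphisms to homomorphisms (`λ ↦ λ^σ`), and «`(Y^σ)~ = Ỹ^f`».
In the tree the abelian variety `A₀` is rational over a field `K`, `γ ∈ Aut(K)`, and `σ̃ ∈ Aut(K̄)` EXTENDS `γ`
(`hσa : σ̃ ∘ ι = ι ∘ γ`); the conjugate `A₀^γ` is `AbelianVariety.conjugate γ A₀` and the conjugate POINT of a geometric
point `x ∈ A₀(K̄)` is read through the canonical isomorphism `(A₀^γ) ⊗_K K̄ ≅ (A₀ ⊗_K K̄)^σ̃`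
(`conjugateBaseChangeAlongIso γ σ̃ hσa A₀`, tree file `Motives/AbelianVarietyConjugateBaseChangeAlong`): this is
EXACTLY the reading used in clause (2′) of the cell's named fact
`GoodReductionAt.HomReduction.exists_isTateCompatible_family_conjFrob` (`Motives/AbelianVarietyGoodReductionConjugateTateGeom`).

## What is here (all in namespace `Literature.AlgebraicGeometry.Motives.AbelianVariety`)

* §1 `isoPointsMulEquiv e L : B(L) ≃* C(L)` for an isomorphism `e : B ≅ C` of abelian varieties.
* §2 **`conjTransport γ σ̃ hσa A₀ : A₀(K̄) ≃+ A₀^γ(K̄)`** (additive, on `geomPoints`), with `toMul_conjTransport` — its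
  value is the (2′) composite VERBATIM (`rfl`) — and `toMul_conjTransport_symm`; the FIRST-PROJECTION FORMULA
  `conjTransport_left_comp_fst`: the point `x^σ̃ ∈ A₀^γ(K̄)` lies over `Spec σ̃ ≫ x : Spec K̄ → A₀` (its coordinates are
  the `σ̃`-conjugates of those of `x`); torsion `conjTransport_mem_geomTorsion_iff`; naturality
  `conjTransport_geomPointsMap'` (`(f x)^σ̃ = f^γ (x^σ̃)` for `f : A₀ → B₀`) and `conjTransport_geomPointsMap`
  (endomorphisms, `β ↦ conjEndEquiv γ A₀ β`); TWISTED GALOIS EQUIVARIANCE `conjTransport_smul_of_semiconj`: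
  `(ρ • x)^σ̃ = τ • x^σ̃` whenever `σ̃ ∘ ρ = τ ∘ σ̃` on `K̄` (e.g. `ρ = σ̃⁻¹ τ σ̃`, the lead's `absGalConjBy σ̃ γ hσa τ`).
* §3 **`conjTransportTateEquiv γ σ̃ hσa A₀ ℓ : T_ℓ A₀ ≃ₗ[ℤ_ℓ] T_ℓ A₀^γ`**, `T_ℓ` of the transport
  (`TateModule.mapEquivOfTorsion`), with `proj_conjTransportTateEquiv` (`rfl`), the existence form
  `exists_tateModuleEquiv_conjTransport`, and the transfers `conjTransportTateEquiv_smul_of_semiconj`,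
  `conjTransportTateEquiv_tateModuleMap'`/`…_tateModuleMap` and their `symm` forms.

## Layering notes

`noncomputable section`; `K : Type` (universe `0`, as in the consumer fact); no `sorry`; axioms ⊆ the standard trio.
HC_CM is proved only modulo the 7 printed citations until rung 0 closes.
-/

set_option autoImplicit false

noncomputable section

open CategoryTheory CategoryTheory.Limits AlgebraicGeometry
open Literature.NumberTheory.EllipticCurves (TateModule)

namespace Literature.AlgebraicGeometry.Motives

namespace AbelianVariety

/-! ## §1 Points along an isomorphism of abelian varieties -/

section IsoPoints

variable {k : Type} [Field k] {B C : AbelianVariety k}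

/-- The group isomorphism `B(L) ≃* C(L)` on `L`-valued points induced by an isomorphism `e : B ≅ C` of abelian
varieties (`P ↦ P ≫ e.hom`, inverse `Q ↦ Q ≫ e.inv`; multiplicative since `e.hom` is a homomorphism of group
schemes, Mathlib `MonObj.mul_comp`). [cite: MumfordAV1970, §4 (homomorphisms act on points)] -/
def isoPointsMulEquiv (e : B ≅ C) (L : Type) [Field L] [Algebra k L] : B.Points L ≃* C.Points L where
  toFun := AlgPoints.map e.hom.hom.hom.hom
  invFun := AlgPoints.map e.inv.hom.hom.hom
  left_inv P := by
    change AlgPoints.map e.inv.hom.hom.hom (AlgPoints.map e.hom.hom.hom.hom P) = P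
    rw [← AlgPoints.map_comp_apply]
    change AlgPoints.map (e.hom ≫ e.inv).hom.hom.hom P = P
    rw [e.hom_inv_id]
    exact AlgPoints.map_id_apply P
  right_inv Q := by
    change AlgPoints.map e.hom.hom.hom.hom (AlgPoints.map e.inv.hom.hom.hom Q) = Q
    rw [← AlgPoints.map_comp_apply]
    change AlgPoints.map (e.inv ≫ e.hom).hom.hom.hom Q = Q
    rw [e.inv_hom_id]
    exact AlgPoints.map_id_apply Q
  map_mul' P Q := by
    change AlgPoints.map e.hom.hom.hom.hom (P * Q) = AlgPoints.map e.hom.hom.hom.hom P * AlgPoints.map e.hom.hom.hom.hom Q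
    exact (IsMonHom.monoidHom e.hom.hom.hom.hom (specOver k L)).map_mul P Q

/-- `isoPointsMulEquiv e L P = P ≫ e.hom`. [cite: MumfordAV1970, §4] -/
@[simp]
theorem isoPointsMulEquiv_apply (e : B ≅ C) (L : Type) [Field L] [Algebra k L] (P : B.Points L) :
    isoPointsMulEquiv e L P = AlgPoints.map e.hom.hom.hom.hom P := rfl

/-- `(isoPointsMulEquiv e L)⁻¹ Q = Q ≫ e.inv`. [cite: MumfordAV1970, §4] -/
@[simp]
theorem isoPointsMulEquiv_symm_apply (e : B ≅ C) (L : Type) [Field L] [Algebra k L] (Q : C.Points L) :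
    (isoPointsMulEquiv e L).symm Q = AlgPoints.map e.inv.hom.hom.hom Q := rfl

/-- `(Q ≫ e.inv) ≫ e.hom = Q` (local copy of the tree's `map_hom_map_inv_points` of
`Motives/AbelianVarietyGoodReductionConjugateGeomTorsion`, kept private to avoid that file's imports). [cite: MumfordAV1970, §4] -/
private theorem map_hom_map_inv_points' (e : B ≅ C) (L : Type) [Field L] [Algebra k L] (Q : C.Points L) :
    AlgPoints.map e.hom.hom.hom.hom (AlgPoints.map e.inv.hom.hom.hom Q) = Q :=
  (isoPointsMulEquiv e L).apply_symm_apply Q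

/-- `(P ≫ e.hom) ≫ e.inv = P`. [cite: MumfordAV1970, §4] -/
private theorem map_inv_map_hom_points' (e : B ≅ C) (L : Type) [Field L] [Algebra k L] (P : B.Points L) :
    AlgPoints.map e.inv.hom.hom.hom (AlgPoints.map e.hom.hom.hom.hom P) = P :=
  (isoPointsMulEquiv e L).symm_apply_apply P

/-- A homomorphism of abelian varieties is multiplicative on `L`-points: `(P Q) ≫ f = (P ≫ f)(Q ≫ f)` (Mathlib
`IsMonHom.monoidHom`). [cite: MumfordAV1970, §4 (homomorphisms act on points)] -/
theorem map_mul_points (f : B ⟶ C) (L : Type) [Field L] [Algebra k L] (P Q : B.Points L) :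
    AlgPoints.map f.hom.hom.hom (P * Q) = AlgPoints.map f.hom.hom.hom P * AlgPoints.map f.hom.hom.hom Q :=
  (IsMonHom.monoidHom f.hom.hom.hom (specOver k L)).map_mul P Q

/-- **Two `M`-valued points of the twist `σA = A ×_{k,σ} K'` with the same projection to `A` are equal** (for ANY
field `M` over `K'`; both lie over `Spec M → Spec K'` by the structure map).  The tree's `Points.ext_of_comp_fst` is
the case `M = K'`. [cite: GortzWedhorn2020, Section (4.7) (points of a base change)] -/
theorem Points.ext_of_comp_fst_of_field {K' : Type} [Field K'] (σ : k →+* K') {A : AbelianVariety k}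
    (M : Type) [Field M] [Algebra K' M] {Q₁ Q₂ : (A.baseChangeAlong σ).Points M}
    (h : Q₁.left ≫ baseChangeHomFst σ A.X = Q₂.left ≫ baseChangeHomFst σ A.X) : Q₁ = Q₂ := by
  ext : 1
  apply pullback.hom_ext
  · exact h
  · have h₁ : Q₁.left ≫ (A.baseChangeAlong σ).X.hom = (specOver K' M).hom := Over.w Q₁
    have h₂ : Q₂.left ≫ (A.baseChangeAlong σ).X.hom = (specOver K' M).hom := Over.w Q₂
    exact h₁.trans h₂.symm

end IsoPoints

/-! ## §2 The `σ̃`-transport of geometric points `A₀(K̄) ≃+ A₀^γ(K̄)` -/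

section Transport

variable {K : Type} [Field K] (γ : K ≃+* K) (σt : AlgebraicClosure K ≃+* AlgebraicClosure K)
  (hσa : ∀ a : K, σt (algebraMap K (AlgebraicClosure K) a) = algebraMap K (AlgebraicClosure K) (γ a))
  (A₀ : AbelianVariety K)

/-- **The `σ̃`-transport `x ↦ x^σ̃ : A₀(K̄) ≃+ A₀^γ(K̄)`** on geometric points (additively written): for `σ̃ ∈ Aut(K̄)`
extending `γ ∈ Aut(K)`, the geometric point `x` of `A₀` is carried along
`A₀(K̄) ≃ (A₀ ⊗ K̄)(K̄) →[x ↦ x^σ̃] ((A₀ ⊗ K̄)^σ̃)(K̄) ≃ ((A₀^γ) ⊗ K̄)(K̄) ≃ A₀^γ(K̄)`, the third arrow along the INVERSE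
of `conjugateBaseChangeAlongIso γ σ̃ hσa A₀ : (A₀^γ) ⊗ K̄ ≅ (A₀ ⊗ K̄)^σ̃` — exactly the reading of `x'` in clause (2′)
of `GoodReductionAt.HomReduction.exists_isTateCompatible_family_conjFrob` (Shimura: «`t ↦ t^σ`» on `A[ℓ^m]`, `x^σ` of
the `K`-rational `A₀` computed on `A₀ ⊗ K̄`). [cite: Shimura1998, §18.6 proof of Thm. 18.6, p. 129] -/
def conjTransport : A₀.geomPoints ≃+ (A₀.conjugate γ).geomPoints where
  toFun x := Additive.ofMul (((A₀.conjugate γ).pointsMulEquiv (AlgebraicClosure K)).symm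
    (AlgPoints.map (conjugateBaseChangeAlongIso γ σt hσa A₀).inv.hom.hom.hom
      ((A₀.baseChange (AlgebraicClosure K)).conjPoints σt
        (A₀.pointsMulEquiv (AlgebraicClosure K) (Additive.toMul x)))))
  invFun y := Additive.ofMul ((A₀.pointsMulEquiv (AlgebraicClosure K)).symm
    (((A₀.baseChange (AlgebraicClosure K)).conjPoints σt).symm
      (AlgPoints.map (conjugateBaseChangeAlongIso γ σt hσa A₀).hom.hom.hom.hom
        ((A₀.conjugate γ).pointsMulEquiv (AlgebraicClosure K) (Additive.toMul y)))))
  left_inv x := by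
    apply Additive.toMul.injective
    simp only [toMul_ofMul, MulEquiv.apply_symm_apply, map_hom_map_inv_points', MulEquiv.symm_apply_apply]
  right_inv y := by
    apply Additive.toMul.injective
    simp only [toMul_ofMul, MulEquiv.apply_symm_apply, map_inv_map_hom_points', MulEquiv.symm_apply_apply]
  map_add' x y := by
    apply Additive.toMul.injective
    have hxy : Additive.toMul (x + y) = Additive.toMul x * Additive.toMul y := rfl
    rw [toMul_ofMul, hxy, map_mul, map_mul, map_mul_points, map_mul]
    rfl

/-- **The value of the transport is the (2′) composite, by `rfl`**: `x^σ̃ = e⁻¹((x_{K̄})^σ̃)` read back in `A₀^γ(K̄)`.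
[cite: Shimura1998, §18.6 proof of Thm. 18.6, p. 129] -/
theorem toMul_conjTransport (x : A₀.geomPoints) :
    Additive.toMul (conjTransport γ σt hσa A₀ x) =
      ((A₀.conjugate γ).pointsMulEquiv (AlgebraicClosure K)).symm
        (AlgPoints.map (conjugateBaseChangeAlongIso γ σt hσa A₀).inv.hom.hom.hom
          ((A₀.baseChange (AlgebraicClosure K)).conjPoints σt
            (A₀.pointsMulEquiv (AlgebraicClosure K) (Additive.toMul x)))) :=
  rfl

/-- The inverse transport, by `rfl`: `y ↦` the point of `A₀` whose `K̄`-model point is `(e (y_{K̄}))^{σ̃⁻¹}`.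
[cite: Shimura1998, §18.6 proof of Thm. 18.6, p. 129] -/
theorem toMul_conjTransport_symm (y : (A₀.conjugate γ).geomPoints) :
    Additive.toMul ((conjTransport γ σt hσa A₀).symm y) =
      (A₀.pointsMulEquiv (AlgebraicClosure K)).symm
        (((A₀.baseChange (AlgebraicClosure K)).conjPoints σt).symm
          (AlgPoints.map (conjugateBaseChangeAlongIso γ σt hσa A₀).hom.hom.hom.hom
            ((A₀.conjugate γ).pointsMulEquiv (AlgebraicClosure K) (Additive.toMul y)))) :=
  rfl

/-- The inverse of `(A₀^γ) ⊗ K̄ ≅ (A₀ ⊗ K̄)^σ̃` followed by the projections `(A₀^γ) ⊗ K̄ → A₀^γ → A₀` is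
`(A₀ ⊗ K̄)^σ̃ → A₀ ⊗ K̄ → A₀` (the first-projection formula of the tree's `conjugateBaseChangeAlongIso`, inverted).
[cite: GortzWedhorn2020, Prop. 4.16 and §(4.7)] -/
theorem conjugateBaseChangeAlongIso_inv_left_comp_fst_fst :
    (conjugateBaseChangeAlongIso γ σt hσa A₀).inv.hom.hom.hom.left ≫
        pullback.fst (A₀.conjugate γ).X.hom (bcSpec K (AlgebraicClosure K)) ≫ baseChangeHomFst γ.toRingHom A₀.X =
      baseChangeHomFst σt.toRingHom (A₀.baseChange (AlgebraicClosure K)).X ≫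
        pullback.fst A₀.X.hom (bcSpec K (AlgebraicClosure K)) := by
  have hid : (conjugateBaseChangeAlongIso γ σt hσa A₀).inv.hom.hom.hom.left ≫
      (conjugateBaseChangeAlongIso γ σt hσa A₀).hom.hom.hom.hom.left = 𝟙 _ := by
    change Hom.toSchemeHom ((conjugateBaseChangeAlongIso γ σt hσa A₀).inv ≫
      (conjugateBaseChangeAlongIso γ σt hσa A₀).hom) = _
    rw [Iso.inv_hom_id]
    rfl
  refine (whisker_eq (conjugateBaseChangeAlongIso γ σt hσa A₀).inv.hom.hom.hom.left
    (toSchemeHom_conjugateBaseChangeAlongIso_hom_comp_fst_fst γ σt hσa A₀)).symm.trans ?_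
  refine (Category.assoc _ _ _).symm.trans ?_
  refine (eq_whisker hid _).trans ?_
  exact Category.id_comp _

/-- **First-projection formula for the transport: `x^σ̃` lies over `Spec σ̃ ≫ x`.**  Composing the point
`x^σ̃ : Spec K̄ → A₀^γ = A₀ ×_{K,γ} K` with the projection to `A₀` gives `Spec σ̃ ≫ x` — i.e. the coordinates of `x^σ̃`
are the `σ̃`-conjugates of the coordinates of `x` (Shimura §17.2 «`x ↦ x^σ` on coordinates»; Charles–Schnell (11.2.1)).
[cite: Shimura1998, §18.6 proof of Thm. 18.6, p. 129] [cite: CharlesSchnell2014Notes, §11.2.2 (11.2.1)] -/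
theorem conjTransport_left_comp_fst (x : A₀.geomPoints) :
    (Additive.toMul (conjTransport γ σt hσa A₀ x)).left ≫ baseChangeHomFst γ.toRingHom A₀.X =
      Spec.map (CommRingCat.ofHom σt.toRingHom) ≫ (Additive.toMul x).left := by
  have h1 : (Additive.toMul (conjTransport γ σt hσa A₀ x)).left =
      (AlgPoints.map (conjugateBaseChangeAlongIso γ σt hσa A₀).inv.hom.hom.hom
        ((A₀.baseChange (AlgebraicClosure K)).conjPoints σt
          (A₀.pointsMulEquiv (AlgebraicClosure K) (Additive.toMul x)))).left ≫
        pullback.fst (A₀.conjugate γ).X.hom (bcSpec K (AlgebraicClosure K)) :=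
    pointsEquiv_symm_apply_left _ _ _
  have h2 : (A₀.pointsMulEquiv (AlgebraicClosure K) (Additive.toMul x)).left ≫
      pullback.fst A₀.X.hom (bcSpec K (AlgebraicClosure K)) = (Additive.toMul x).left := by
    rw [pointsMulEquiv_apply, pointsEquiv_apply_left_comp_fst]
  rw [h1]
  refine (Category.assoc _ _ _).trans ?_
  change (((A₀.baseChange (AlgebraicClosure K)).conjPoints σt
      (A₀.pointsMulEquiv (AlgebraicClosure K) (Additive.toMul x))).left ≫
        (conjugateBaseChangeAlongIso γ σt hσa A₀).inv.hom.hom.hom.left) ≫ _ = _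
  refine (Category.assoc _ _ _).trans ?_
  refine (whisker_eq _ (conjugateBaseChangeAlongIso_inv_left_comp_fst_fst γ σt hσa A₀)).trans ?_
  refine (conjPoints_left_comp_fst_assoc σt _ _).trans ?_
  exact whisker_eq _ h2

variable {γ σt A₀}

/-- **`x ↦ x^σ̃` preserves `m`-torsion exactly**: `x^σ̃ ∈ A₀^γ[m](K̄) ↔ x ∈ A₀[m](K̄)` (a group isomorphism preserves
the order of elements; Shimura §17.1–17.2: `t_i ↦ t_i^σ` on points of finite order).
[cite: Shimura1998, §18.6 proof of Thm. 18.6, p. 129] -/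
theorem conjTransport_mem_geomTorsion_iff (m : ℤ) (x : A₀.geomPoints) :
    conjTransport γ σt hσa A₀ x ∈ (A₀.conjugate γ).geomTorsion m ↔ x ∈ A₀.geomTorsion m := by
  rw [mem_geomTorsion_iff', mem_geomTorsion_iff', ← map_zsmul, AddEquiv.map_eq_zero_iff]

/-- **Naturality of the transport in homomorphisms: `(f x)^σ̃ = f^γ (x^σ̃)`** for `f : A₀ → B₀` over `K`
(Shimura: `λ ↦ λ^σ`, `(λ t)^σ = λ^σ t^σ`; Milne's functor `σ`): both sides lie over `Spec σ̃ ≫ x ≫ f`.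
[cite: Shimura1998, §18.6 proof of Thm. 18.6, p. 129] [cite: Milne2005ShimuraVarieties, §11 p. 108 («the functor σ»)] -/
theorem conjTransport_geomPointsMap' {B₀ : AbelianVariety K} (f : A₀ ⟶ B₀) (x : A₀.geomPoints) :
    conjTransport γ σt hσa B₀ (Hom.geomPointsMap f x) =
      Hom.geomPointsMap (Hom.conjugate γ f) (conjTransport γ σt hσa A₀ x) := by
  apply Additive.toMul.injective
  refine Points.ext_of_comp_fst_of_field γ.toRingHom (AlgebraicClosure K) ?_
  have hf : (Hom.conjugate γ f).hom.hom.hom.left ≫ baseChangeHomFst γ.toRingHom B₀.X =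
      baseChangeHomFst γ.toRingHom A₀.X ≫ f.hom.hom.hom.left :=
    Hom.toSchemeHom_baseChangeAlong_comp_fst γ.toRingHom f
  -- left-hand side: `Spec σ̃ ≫ x ≫ f`
  refine (conjTransport_left_comp_fst γ σt hσa B₀ _).trans ?_
  change Spec.map (CommRingCat.ofHom σt.toRingHom) ≫ ((Additive.toMul x).left ≫ f.hom.hom.hom.left) = _
  symm
  -- right-hand side: `(x^σ̃ ≫ f^γ) ≫ pr = x^σ̃ ≫ pr ≫ f = Spec σ̃ ≫ x ≫ f`
  change ((Additive.toMul (conjTransport γ σt hσa A₀ x)).left ≫ (Hom.conjugate γ f).hom.hom.hom.left) ≫ _ = _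
  refine (Category.assoc _ _ _).trans ?_
  refine (whisker_eq _ hf).trans ?_
  refine (Category.assoc _ _ _).symm.trans ?_
  refine (eq_whisker (conjTransport_left_comp_fst γ σt hσa A₀ x) _).trans ?_
  exact Category.assoc _ _ _

/-- **Naturality for endomorphisms: `(β x)^σ̃ = β^γ (x^σ̃)`** with `β^γ = conjEndEquiv γ A₀ β` (Shimura's `ι^σ`:
the structure `ι : 𝓞_K → End A₀` goes to `ι^σ(a) = ι(a)^σ`). [cite: Shimura1998, §18.6 proof of Thm. 18.6, p. 129] -/
theorem conjTransport_geomPointsMap (β : End A₀) (x : A₀.geomPoints) :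
    conjTransport γ σt hσa A₀ (Hom.geomPointsMap (β : A₀ ⟶ A₀) x) =
      Hom.geomPointsMap (A₀.conjEndEquiv γ β : A₀.conjugate γ ⟶ A₀.conjugate γ) (conjTransport γ σt hσa A₀ x) :=
  conjTransport_geomPointsMap' hσa β x

/-- **Twisted Galois equivariance: `(ρ • x)^σ̃ = τ • x^σ̃` whenever `σ̃ ∘ ρ = τ ∘ σ̃` on `K̄`** (`ρ, τ ∈ Gal(K̄/K)`;
e.g. `ρ = σ̃⁻¹ τ σ̃`, the lead's `absGalConjBy σ̃ γ hσa τ`).  Both sides lie over `Spec(σ̃ ∘ ρ) = Spec(τ ∘ σ̃) ≫ x`;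
the Galois action is `σ • P = Spec σ ≫ P` (apply `σ` to the coordinates, `AlgPoints.absoluteGaloisGroup_smul_def`).
This is how the action of an inertia group / a Frobenius at `𝔓` on `A₀^γ(K̄)` is read on `A₀(K̄)` after conjugating
by `σ̃` (Shimura p. 129, the element `σ` acting on `t ∈ A[ℓ^m]` and on `t^σ`).
[cite: Shimura1998, §18.6 proof of Thm. 18.6, p. 129] -/
theorem conjTransport_smul_of_semiconj (ρ τ : Field.absoluteGaloisGroup K)
    (h : ∀ y : AlgebraicClosure K, σt (ρ • y) = τ • σt y) (x : A₀.geomPoints) :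
    conjTransport γ σt hσa A₀ (ρ • x) = τ • conjTransport γ σt hσa A₀ x := by
  apply Additive.toMul.injective
  refine Points.ext_of_comp_fst_of_field γ.toRingHom (AlgebraicClosure K) ?_
  -- left-hand side: `Spec σ̃ ≫ Spec ρ ≫ x`; right-hand side: `Spec τ ≫ Spec σ̃ ≫ x`
  refine (conjTransport_left_comp_fst γ σt hσa A₀ _).trans ?_
  rw [AbelianVariety.toMul_smul, AbelianVariety.toMul_smul, AlgPoints.absoluteGaloisGroup_smul_def,
    AlgPoints.absoluteGaloisGroup_smul_def, Over.comp_left, Over.comp_left, AlgPoints.specMap_left,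
    AlgPoints.specMap_left]
  symm
  refine (Category.assoc _ _ _).trans ?_
  refine (whisker_eq _ (conjTransport_left_comp_fst γ σt hσa A₀ x)).trans ?_
  refine (Category.assoc _ _ _).symm.trans ?_
  refine Eq.trans ?_ (Category.assoc _ _ _)
  refine (eq_whisker (Spec.map_comp _ _).symm _).trans ?_
  refine Eq.trans ?_ (eq_whisker (Spec.map_comp _ _) _)
  congr 2
  ext y
  exact (h y).symm

end Transport


/-! ## §3 The lift to the Tate module `T_ℓ A₀ ≃ₗ[ℤ_ℓ] T_ℓ A₀^γ` -/

section Tate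

variable {K : Type} [Field K] (γ : K ≃+* K) (σt : AlgebraicClosure K ≃+* AlgebraicClosure K)
  (hσa : ∀ a : K, σt (algebraMap K (AlgebraicClosure K) a) = algebraMap K (AlgebraicClosure K) (γ a))
  (A₀ : AbelianVariety K) (ℓ : ℕ) [Fact ℓ.Prime]

/-- **`T_ℓ` of the transport: `T_ℓ A₀ ≃ₗ[ℤ_ℓ] T_ℓ A₀^γ`, `(a_n)_n ↦ (a_n^σ̃)_n`** (`T_ℓ` of the group isomorphism
`x ↦ x^σ̃`, the tree's `TateModule.mapEquivOfTorsion`; Shimura: `σ` on the `ℓ`-adic representations via `t ↦ t^σ`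
on all `A[ℓ^m]`). [cite: Shimura1998, §18.6 proof of Thm. 18.6, p. 129] -/
def conjTransportTateEquiv : A₀.tateModule ℓ ≃ₗ[ℤ_[ℓ]] (A₀.conjugate γ).tateModule ℓ :=
  TateModule.mapEquivOfTorsion (conjTransport γ σt hσa A₀).toAddMonoidHom (conjTransport γ σt hσa A₀).injective
    fun _ b _ => ⟨(conjTransport γ σt hσa A₀).symm b, (conjTransport γ σt hσa A₀).apply_symm_apply b⟩

/-- Components: `(E a)_n = (a_n)^σ̃` (`rfl`). [cite: Shimura1998, §18.6 proof of Thm. 18.6, p. 129] -/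
@[simp]
theorem proj_conjTransportTateEquiv (a : A₀.tateModule ℓ) (n : ℕ) :
    TateModule.proj ℓ n (conjTransportTateEquiv γ σt hσa A₀ ℓ a) = conjTransport γ σt hσa A₀ (TateModule.proj ℓ n a) :=
  rfl

/-- Components of the inverse: `((E⁻¹ b)_n)^σ̃ = b_n`. [cite: Shimura1998, §18.6 proof of Thm. 18.6, p. 129] -/
theorem conjTransport_proj_conjTransportTateEquiv_symm (b : (A₀.conjugate γ).tateModule ℓ) (n : ℕ) :
    conjTransport γ σt hσa A₀ (TateModule.proj ℓ n ((conjTransportTateEquiv γ σt hσa A₀ ℓ).symm b)) =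
      TateModule.proj ℓ n b := by
  rw [← proj_conjTransportTateEquiv, LinearEquiv.apply_symm_apply]

/-- Components of the inverse: `(E⁻¹ b)_n = (b_n)^{σ̃⁻¹}`. [cite: Shimura1998, §18.6 proof of Thm. 18.6, p. 129] -/
theorem proj_conjTransportTateEquiv_symm (b : (A₀.conjugate γ).tateModule ℓ) (n : ℕ) :
    TateModule.proj ℓ n ((conjTransportTateEquiv γ σt hσa A₀ ℓ).symm b) =
      (conjTransport γ σt hσa A₀).symm (TateModule.proj ℓ n b) := by
  rw [← conjTransport_proj_conjTransportTateEquiv_symm γ σt hσa A₀ ℓ b n, AddEquiv.symm_apply_apply]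

/-- **Existence form** (the lead's slot L1e): a `ℤ_ℓ`-linear isomorphism `T_ℓ A₀ ≃ T_ℓ A₀^γ` with components
`x ↦ x^σ̃`. [cite: Shimura1998, §18.6 proof of Thm. 18.6, p. 129] -/
theorem exists_tateModuleEquiv_conjTransport :
    ∃ E : A₀.tateModule ℓ ≃ₗ[ℤ_[ℓ]] (A₀.conjugate γ).tateModule ℓ,
      ∀ (a : A₀.tateModule ℓ) (n : ℕ),
        (TateModule.proj ℓ n (E a) : (A₀.conjugate γ).geomPoints) = conjTransport γ σt hσa A₀ (TateModule.proj ℓ n a) :=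
  ⟨conjTransportTateEquiv γ σt hσa A₀ ℓ, fun _ _ => rfl⟩

variable {γ σt A₀ ℓ}

/-- **Twisted Galois equivariance on `T_ℓ`: `E (ρ • a) = τ • E a` whenever `σ̃ ∘ ρ = τ ∘ σ̃`** (componentwise
`conjTransport_smul_of_semiconj`). [cite: Shimura1998, §18.6 proof of Thm. 18.6, p. 129] -/
theorem conjTransportTateEquiv_smul_of_semiconj (ρ τ : Field.absoluteGaloisGroup K)
    (h : ∀ y : AlgebraicClosure K, σt (ρ • y) = τ • σt y) (a : A₀.tateModule ℓ) :
    conjTransportTateEquiv γ σt hσa A₀ ℓ (ρ • a) = τ • conjTransportTateEquiv γ σt hσa A₀ ℓ a :=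
  TateModule.ext fun n => by
    rw [proj_conjTransportTateEquiv, TateModule.proj_smul_of_distribMulAction,
      TateModule.proj_smul_of_distribMulAction, proj_conjTransportTateEquiv, conjTransport_smul_of_semiconj hσa ρ τ h]

/-- … and for the inverse: `E⁻¹ (τ • b) = ρ • E⁻¹ b` whenever `σ̃ ∘ ρ = τ ∘ σ̃`.
[cite: Shimura1998, §18.6 proof of Thm. 18.6, p. 129] -/
theorem conjTransportTateEquiv_symm_smul_of_semiconj (ρ τ : Field.absoluteGaloisGroup K)
    (h : ∀ y : AlgebraicClosure K, σt (ρ • y) = τ • σt y) (b : (A₀.conjugate γ).tateModule ℓ) :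
    (conjTransportTateEquiv γ σt hσa A₀ ℓ).symm (τ • b) = ρ • (conjTransportTateEquiv γ σt hσa A₀ ℓ).symm b := by
  apply (conjTransportTateEquiv γ σt hσa A₀ ℓ).injective
  rw [LinearEquiv.apply_symm_apply, conjTransportTateEquiv_smul_of_semiconj hσa ρ τ h, LinearEquiv.apply_symm_apply]

/-- **Naturality on `T_ℓ`: `E_B (T_ℓ(f) a) = T_ℓ(f^γ) (E_A a)`** for `f : A₀ → B₀` (componentwise
`conjTransport_geomPointsMap'`). [cite: Shimura1998, §18.6 proof of Thm. 18.6, p. 129] -/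
theorem conjTransportTateEquiv_tateModuleMap' {B₀ : AbelianVariety K} (f : A₀ ⟶ B₀) (a : A₀.tateModule ℓ) :
    conjTransportTateEquiv γ σt hσa B₀ ℓ (tateModuleMap ℓ f a) =
      tateModuleMap ℓ (Hom.conjugate γ f) (conjTransportTateEquiv γ σt hσa A₀ ℓ a) :=
  TateModule.ext fun n => by
    rw [proj_conjTransportTateEquiv, proj_tateModuleMap, proj_tateModuleMap, proj_conjTransportTateEquiv,
      conjTransport_geomPointsMap']

/-- **Naturality on `T_ℓ` for endomorphisms: `E (T_ℓ(β) a) = T_ℓ(β^γ) (E a)`**, `β^γ = conjEndEquiv γ A₀ β` — the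
shape of `TateSpecialisation.equiv_tateModuleMap` after transport. [cite: Shimura1998, §18.6 proof of Thm. 18.6, p. 129] -/
theorem conjTransportTateEquiv_tateModuleMap (β : End A₀) (a : A₀.tateModule ℓ) :
    conjTransportTateEquiv γ σt hσa A₀ ℓ (tateModuleMap ℓ (β : A₀ ⟶ A₀) a) =
      tateModuleMap ℓ (A₀.conjEndEquiv γ β : A₀.conjugate γ ⟶ A₀.conjugate γ)
        (conjTransportTateEquiv γ σt hσa A₀ ℓ a) :=
  conjTransportTateEquiv_tateModuleMap' hσa β a

/-- … and for the inverse: `E⁻¹ (T_ℓ(β^γ) b) = T_ℓ(β) (E⁻¹ b)`. [cite: Shimura1998, §18.6 proof of Thm. 18.6, p. 129] -/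
theorem conjTransportTateEquiv_symm_tateModuleMap (β : End A₀) (b : (A₀.conjugate γ).tateModule ℓ) :
    (conjTransportTateEquiv γ σt hσa A₀ ℓ).symm
        (tateModuleMap ℓ (A₀.conjEndEquiv γ β : A₀.conjugate γ ⟶ A₀.conjugate γ) b) =
      tateModuleMap ℓ (β : A₀ ⟶ A₀) ((conjTransportTateEquiv γ σt hσa A₀ ℓ).symm b) := by
  apply (conjTransportTateEquiv γ σt hσa A₀ ℓ).injective
  rw [LinearEquiv.apply_symm_apply, conjTransportTateEquiv_tateModuleMap hσa β, LinearEquiv.apply_symm_apply]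

end Tate

end AbelianVariety

end Literature.AlgebraicGeometry.Motives

end
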